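import Mathlib
import HarnessLib
import Summits.Ventures.LatticeQCDFlow.Scoring.SelfNormalisedReweightingCeilingFree

/-!
# The reweighting column for UNBOUNDED observables, no weight ceiling: the median over `R` blocks
# of `Σ_j w_j O_j / m` (and of the printed `Σ_j w̃_j O_j / Σ_j w̃_j`) certifies `E_p O` at
# exponential confidence as soon as `O ∈ L²(p²/q dμ)` — the weighted second moment
# `V = ∫ (p²/q)·O² dμ` replaces `‖O‖²_∞·M₂`

HONEST FRAMING: exact (Metropolis-corrected) sampling algorithms for lattice gauge theory;
figures of merit are autocorrelation/cost numbers at stated couplings and volumes; no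
continuum-physics claim.

Venture `LatticeQCDFlow` (cell pub-lqcd), topic `Scoring`; FANOUT row 4 (`s0-u1-b`, rung S0-B).
Row 4's `Scoring/ReweightingMedianOfBlocks` and `Scoring/SelfNormalisedReweightingCeilingFree`
certify the reweighted estimate of `E_p O = ∫ p·O dμ` from ONE proposal stream cut into `R` blocks
for a BOUNDED observable `|O| ≤ B` (radius driven by `B²M₂`, `M₂ = ∫ p²/q dμ = 1/ESS`) and list
'unbounded observables (replace `B²M₂` by `∫ (p²/q) O² dμ`, which is what the proof uses)' as NOT
CLAIMED.  This file is that replacement.  The only analytic input on `O` is measurability and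
`(p²/q)·O² ∈ L¹(μ)` — stated as `Integrable`, no junk Bochner bound — i.e. `w·O ∈ L²(q dμ)`
(`w = p/q`) with `E_q (wO)² = V`; then `Var_q(wO) ≤ V`, `|E_p O| ≤ √V`, Chebyshev per block,
independence of the blocks (grouping, `AllPairsMedian.iIndepFun_blockFun`) and row 4's median
device `BlockMedian.measureReal_half_far_le` give the certificates; the bounded case is recovered by
`weightedSecondMoment_le_of_bounded` (`V ≤ B²M₂`).  The classical median-of-means estimator
(Nemirovsky–Yudin 1983; Devroye–Lerasle–Lugosi–Oliveira 2016; Lugosi–Mendelson 2019 §2) is NAMED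
ONLY; NEW WORK of the cell (elementary); no definition; nothing cited as a fact.

## Content (`ν = μ.withDensity q`; `w = p/q`; `V = ∫ (p²/q)·O² dμ`; `M₂ = ∫ p²/q dμ`; block `r` =
## draws `rm, …, rm + m − 1`; `Ê_r = Σ_j w_j O_j / m`, `S_r = Σ_j w̃_j O_j / Σ_j w̃_j`)

* §1 `memLp_weightMul_model_of_sq` (`wO ∈ L²(ν)`), `integral_sq_weightMul_model`
  (`∫ (wO)² dν = V`), **`variance_weightMul_model_le_sq`** (`Var_ν(wO) ≤ V`),
  `sq_integral_targetMul_le` (`(∫ p·O dμ)² ≤ V`), `abs_integral_targetMul_le_sqrt`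
  (`|∫ p·O dμ| ≤ √V`), `weightedSecondMoment_le_of_bounded` (`|O| ≤ B` ⇒ `V ≤ B²M₂`).
* §2 **`reweighting_medianOfBlocks_confidence_of_sq`** — `m ≥ 1`, `R·m ≤ n`, `t > 0`,
  `4V ≤ m t²`: `P(#{r < R : t ≤ |Ê_r − ∫ p·O dμ|} ≥ R/2) ≤ exp(−R/8)`;
  `reweighting_sampleMedian_confidence_of_sq`.
* §3 the PRINTED self-normalised estimate with ANY normalisation `w̃ = c·p/q`, `c > 0`:
  **`selfNormReweighting_medianOfBlocks_confidence_of_sq`** — `8V ≤ m t²`, `8(M₂ − 1) ≤ m u²`,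
  `0 < u < 1` ⇒ `P(#{r < R : (t + √V·u)/(1 − u) ≤ |S_r − ∫ p·O dμ|} ≥ R/2) ≤ exp(−R/8)`;
  `selfNormReweighting_sampleMedian_confidence_of_sq`.

Reading (value-free): `R ≈ 8 log(1/η)` blocks of `m` proposals certify the reweighted estimate
of any `O` with `V = E_p[(p/q)·O²] < ∞` to `± 2√(V/m)` (printed ratio: `± (t + √V u)/(1 − u)`,
`t² ≥ 8V/m`, `u² ≥ 8(1/ESS − 1)/m`) at confidence `1 − η`.  NOT CLAIMED: estimating `V` or `M₂`
(inputs); heavier tails (`O ∉ L²(p²/q dμ)`); the chain-side column; any number of ours re-scored.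
-/

noncomputable section

namespace Summit.Ventures.LatticeQCDFlow.Scoring.ReweightingMedian

open MeasureTheory ProbabilityTheory Finset Real Set
open Summit.Ventures.LatticeQCDFlow.Scoring.BlockMedian
open Summit.Ventures.LatticeQCDFlow.Scoring.AllPairsMedian

/-! ## §1 The weighted observable under the model law at the second moment -/

section Model

variable {X : Type*} [MeasurableSpace X] {μ : Measure X} {p q O : X → ℝ}

/-- **`w·O ∈ L²(q dμ)`** from `(p²/q)·O² ∈ L¹(μ)` (`(wO)²·q = (p²/q)·O²`); no sup bound. [ours] -/
theorem memLp_weightMul_model_of_sq (hpm : Measurable p) (hq0 : ∀ z, 0 < q z) (hqm : Measurable q)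
    (hOm : Measurable O) (hVi : Integrable (fun z => p z ^ 2 / q z * O z ^ 2) μ) :
    MemLp (fun a => p a / q a * O a) 2 (μ.withDensity fun z => ENNReal.ofReal (q z)) := by
  have hfm : Measurable (fun a => p a / q a * O a) := (hpm.div hqm).mul hOm
  rw [memLp_two_iff_integrable_sq hfm.aestronglyMeasurable,
    AllPairsVariance.integrable_withDensity_iff' (fun z => (hq0 z).le) hqm]
  have h : (fun a => (p a / q a * O a) ^ 2 * q a) = fun a => p a ^ 2 / q a * O a ^ 2 := by
    funext a
    have hqa : q a ≠ 0 := (hq0 a).ne'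
    field_simp
  rw [h]
  exact hVi

/-- `∫ (wO)² d(q dμ) = ∫ (p²/q)·O² dμ = V`. [ours] -/
theorem integral_sq_weightMul_model (hq0 : ∀ z, 0 < q z) (hqm : Measurable q) :
    ∫ a, (p a / q a * O a) ^ 2 ∂(μ.withDensity fun z => ENNReal.ofReal (q z))
      = ∫ z, p z ^ 2 / q z * O z ^ 2 ∂μ := by
  rw [AllPairsVariance.integral_withDensity_eq' (fun z => (hq0 z).le) hqm]
  refine integral_congr_ae (Filter.Eventually.of_forall fun a => ?_)
  show (p a / q a * O a) ^ 2 * q a = p a ^ 2 / q a * O a ^ 2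
  have hqa : q a ≠ 0 := (hq0 a).ne'
  field_simp

/-- **`Var_{q dμ}(w·O) ≤ V = ∫ (p²/q)·O² dμ`** (variance ≤ second moment). [ours] -/
theorem variance_weightMul_model_le_sq
    (hν : IsProbabilityMeasure (μ.withDensity fun z => ENNReal.ofReal (q z)))
    (hpm : Measurable p) (hq0 : ∀ z, 0 < q z) (hqm : Measurable q) (hOm : Measurable O)
    (hVi : Integrable (fun z => p z ^ 2 / q z * O z ^ 2) μ) :
    Var[fun a => p a / q a * O a; μ.withDensity fun z => ENNReal.ofReal (q z)]
      ≤ ∫ z, p z ^ 2 / q z * O z ^ 2 ∂μ := by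
  rw [variance_eq_sub (memLp_weightMul_model_of_sq hpm hq0 hqm hOm hVi)]
  simp only [Pi.pow_apply]
  rw [integral_sq_weightMul_model hq0 hqm]
  nlinarith [sq_nonneg (∫ a, p a / q a * O a ∂(μ.withDensity fun z => ENNReal.ofReal (q z)))]

/-- **`(E_p O)² = (∫ p·O dμ)² ≤ V`** (`∫ p·O dμ = E_ν(wO)` and `0 ≤ Var_ν(wO) = V − (E_ν(wO))²`).
[ours] -/
theorem sq_integral_targetMul_le
    (hν : IsProbabilityMeasure (μ.withDensity fun z => ENNReal.ofReal (q z)))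
    (hpm : Measurable p) (hq0 : ∀ z, 0 < q z) (hqm : Measurable q) (hOm : Measurable O)
    (hVi : Integrable (fun z => p z ^ 2 / q z * O z ^ 2) μ) :
    (∫ z, p z * O z ∂μ) ^ 2 ≤ ∫ z, p z ^ 2 / q z * O z ^ 2 ∂μ := by
  have h := variance_nonneg (fun a => p a / q a * O a) (μ.withDensity fun z => ENNReal.ofReal (q z))
  rw [variance_eq_sub (memLp_weightMul_model_of_sq hpm hq0 hqm hOm hVi)] at h
  simp only [Pi.pow_apply] at h
  rw [integral_sq_weightMul_model hq0 hqm, integral_weightMul_model hq0 hqm] at h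
  linarith

/-- `|E_p O| = |∫ p·O dμ| ≤ √V`. [ours] -/
theorem abs_integral_targetMul_le_sqrt
    (hν : IsProbabilityMeasure (μ.withDensity fun z => ENNReal.ofReal (q z)))
    (hpm : Measurable p) (hq0 : ∀ z, 0 < q z) (hqm : Measurable q) (hOm : Measurable O)
    (hVi : Integrable (fun z => p z ^ 2 / q z * O z ^ 2) μ) :
    |∫ z, p z * O z ∂μ| ≤ Real.sqrt (∫ z, p z ^ 2 / q z * O z ^ 2 ∂μ) :=
  Real.abs_le_sqrt (sq_integral_targetMul_le hν hpm hq0 hqm hOm hVi)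

/-- **The bounded case is a special case**: `|O| ≤ B` measurable and `p²/q ∈ L¹(μ)` give
`(p²/q)·O² ∈ L¹(μ)` and `V ≤ B²M₂`. [ours] -/
theorem weightedSecondMoment_le_of_bounded (hpm : Measurable p) (hq0 : ∀ z, 0 < q z)
    (hqm : Measurable q) (hM2i : Integrable (fun z => p z ^ 2 / q z) μ) (hOm : Measurable O)
    {B : ℝ} (hOB : ∀ z, |O z| ≤ B) :
    Integrable (fun z => p z ^ 2 / q z * O z ^ 2) μ
      ∧ ∫ z, p z ^ 2 / q z * O z ^ 2 ∂μ ≤ B ^ 2 * ∫ z, p z ^ 2 / q z ∂μ := by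
  have hle : ∀ z, p z ^ 2 / q z * O z ^ 2 ≤ B ^ 2 * (p z ^ 2 / q z) := fun z => by
    rw [mul_comm (B ^ 2)]
    refine mul_le_mul_of_nonneg_left ?_ (div_nonneg (sq_nonneg _) (hq0 z).le)
    calc O z ^ 2 = |O z| ^ 2 := (sq_abs _).symm
      _ ≤ B ^ 2 := pow_le_pow_left₀ (abs_nonneg _) (hOB z) 2
  have hint : Integrable (fun z => p z ^ 2 / q z * O z ^ 2) μ := by
    refine Integrable.mono' (hM2i.const_mul (B ^ 2))
      ((((hpm.pow_const 2).div hqm).mul (hOm.pow_const 2)).aestronglyMeasurable)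
      (Filter.Eventually.of_forall fun z => ?_)
    rw [Real.norm_eq_abs, abs_of_nonneg (mul_nonneg (div_nonneg (sq_nonneg _) (hq0 z).le)
      (sq_nonneg _))]
    exact hle z
  refine ⟨hint, ?_⟩
  calc ∫ z, p z ^ 2 / q z * O z ^ 2 ∂μ ≤ ∫ z, B ^ 2 * (p z ^ 2 / q z) ∂μ :=
        integral_mono hint (hM2i.const_mul _) hle
    _ = B ^ 2 * ∫ z, p z ^ 2 / q z ∂μ := integral_const_mul _ _

end Model

/-! ## §2 The reweighting estimator of a weighted-square-integrable observable -/

section Reweighting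

variable {Ω : Type*} [MeasurableSpace Ω] {P : Measure Ω} [IsProbabilityMeasure P]
variable {X : Type*} [MeasurableSpace X] {μ : Measure X} {p q O : X → ℝ} {n m R : ℕ}

/-- **THE REWEIGHTING COLUMN, NO CEILING, NO SUP BOUND.**  `n` independent model draws `y_j`
(laws `μ.withDensity q`), `q > 0` measurable, `p` measurable, `O` measurable with
`(p²/q)·O² ∈ L¹(μ)` (`V = ∫ (p²/q)·O² dμ`); blocks of `m ≥ 1` draws, `R·m ≤ n`; `t > 0` with
`4V ≤ m t²`.  With `Ê_r = Σ_{j<m} w(y_{rm+j}) O(y_{rm+j}) / m`: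
`P( #{r < R : t ≤ |Ê_r − ∫ p·O dμ|} ≥ R/2 ) ≤ exp(−R/8)`. [ours] -/
theorem reweighting_medianOfBlocks_confidence_of_sq {y : Fin n → Ω → X}
    (hym : ∀ j, Measurable (y j)) (hind : iIndepFun y P) (hpm : Measurable p)
    (hq0 : ∀ z, 0 < q z) (hqm : Measurable q) (hOm : Measurable O)
    (hVi : Integrable (fun z => p z ^ 2 / q z * O z ^ 2) μ)
    (hlaw : ∀ j, Measure.map (y j) P = μ.withDensity fun z => ENNReal.ofReal (q z))
    (hm : 1 ≤ m) (hRm : R * m ≤ n) {t : ℝ} (ht : 0 < t)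
    (hvt : 4 * ∫ z, p z ^ 2 / q z * O z ^ 2 ∂μ ≤ m * t ^ 2) :
    P.real {ω | (R : ℝ) / 2 ≤ #{r ∈ (univ : Finset (Fin R)) | t ≤
        |(∑ j : Fin m, p (y ⟨((r : Fin R) : ℕ) * m + j, mul_add_lt hRm r j⟩ ω)
            / q (y ⟨((r : Fin R) : ℕ) * m + j, mul_add_lt hRm r j⟩ ω)
            * O (y ⟨((r : Fin R) : ℕ) * m + j, mul_add_lt hRm r j⟩ ω)) / m
          - ∫ z, p z * O z ∂μ|}} ≤ exp (-(R / 8)) := by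
  rcases Nat.eq_zero_or_pos R with hR | hR
  · subst hR
    refine measureReal_le_one.trans ?_
    simp
  have hn : 0 < n := by
    have : 0 < R * m := Nat.mul_pos hR (by omega)
    omega
  have hν : IsProbabilityMeasure (μ.withDensity fun z => ENNReal.ofReal (q z)) :=
    isProbabilityMeasure_of_map_eq_iid (hym ⟨0, hn⟩) (hlaw ⟨0, hn⟩)
  have h := blockMean_medianOfBlocks_confidence (ν := μ.withDensity fun z => ENNReal.ofReal (q z))
    (g := fun a => p a / q a * O a) hym hind hlaw ((hpm.div hqm).mul hOm)
    (memLp_weightMul_model_of_sq hpm hq0 hqm hOm hVi) hm hRm ht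
    ((mul_le_mul_of_nonneg_left (variance_weightMul_model_le_sq hν hpm hq0 hqm hOm hVi)
      (by norm_num)).trans hvt)
  rw [integral_weightMul_model hq0 hqm] at h
  exact h

/-- **THE REWEIGHTING COLUMN, NO CEILING, NO SUP BOUND, for ANY sample median** `med(ω)` of the
`R` block estimates: `4V ≤ m t²` ⇒ `P(t ≤ |med − ∫ p·O dμ|) ≤ exp(−R/8)`. [ours] -/
theorem reweighting_sampleMedian_confidence_of_sq {y : Fin n → Ω → X}
    (hym : ∀ j, Measurable (y j)) (hind : iIndepFun y P) (hpm : Measurable p)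
    (hq0 : ∀ z, 0 < q z) (hqm : Measurable q) (hOm : Measurable O)
    (hVi : Integrable (fun z => p z ^ 2 / q z * O z ^ 2) μ)
    (hlaw : ∀ j, Measure.map (y j) P = μ.withDensity fun z => ENNReal.ofReal (q z))
    (hm : 1 ≤ m) (hRm : R * m ≤ n) {t : ℝ} (ht : 0 < t)
    (hvt : 4 * ∫ z, p z ^ 2 / q z * O z ^ 2 ∂μ ≤ m * t ^ 2) {med : Ω → ℝ}
    (hlo : ∀ ω, (R : ℝ) / 2 ≤ #{r ∈ (univ : Finset (Fin R)) | med ω ≤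
        (∑ j : Fin m, p (y ⟨((r : Fin R) : ℕ) * m + j, mul_add_lt hRm r j⟩ ω)
            / q (y ⟨((r : Fin R) : ℕ) * m + j, mul_add_lt hRm r j⟩ ω)
            * O (y ⟨((r : Fin R) : ℕ) * m + j, mul_add_lt hRm r j⟩ ω)) / m})
    (hhi : ∀ ω, (R : ℝ) / 2 ≤ #{r ∈ (univ : Finset (Fin R)) |
        (∑ j : Fin m, p (y ⟨((r : Fin R) : ℕ) * m + j, mul_add_lt hRm r j⟩ ω)
            / q (y ⟨((r : Fin R) : ℕ) * m + j, mul_add_lt hRm r j⟩ ω)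
            * O (y ⟨((r : Fin R) : ℕ) * m + j, mul_add_lt hRm r j⟩ ω)) / m ≤ med ω}) :
    P.real {ω | t ≤ |med ω - ∫ z, p z * O z ∂μ|} ≤ exp (-(R / 8)) := by
  refine (measureReal_mono ?_).trans
    (reweighting_medianOfBlocks_confidence_of_sq hym hind hpm hq0 hqm hOm hVi hlaw hm hRm ht hvt)
  intro ω hω
  simp only [Set.mem_setOf_eq] at hω ⊢
  by_contra hlt
  push Not at hlt
  have hR : (#(univ : Finset (Fin R)) : ℝ) = R := by rw [card_univ, Fintype.card_fin]
  have h := abs_median_sub_lt_of_card_lt (univ : Finset (Fin R)) _ (hR ▸ hlo ω) (hR ▸ hhi ω)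
    (hR ▸ hlt)
  linarith

end Reweighting

/-! ## §3 The printed self-normalised estimate of a weighted-square-integrable observable -/

section SelfNorm

variable {Ω : Type*} [MeasurableSpace Ω] {P : Measure Ω} [IsProbabilityMeasure P]
variable {X : Type*} [MeasurableSpace X] {μ : Measure X} {p q O : X → ℝ} {n m R : ℕ}

/-- **THE PRINTED SELF-NORMALISED REWEIGHTING ESTIMATE, NO CEILING, NO SUP BOUND.**  `n`
independent model draws `y_j` (laws `μ.withDensity q`); `p` measurable, integrable, `∫ p = 1`,
`p²/q ∈ L¹(μ)` (`M₂`); `q > 0` measurable; `O` measurable with `(p²/q)·O² ∈ L¹(μ)` (`V`); weights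
printed with ANY normalisation `w̃ = c·p/q`, `c > 0`; blocks of `m ≥ 1` draws, `R·m ≤ n`; `t > 0`,
`0 < u < 1` with `8V ≤ m t²` and `8(M₂ − 1) ≤ m u²`.  With `S_r = Σ_j w̃_j O_j / Σ_j w̃_j`:
`P( #{r < R : (t + √V·u)/(1 − u) ≤ |S_r − ∫ p·O dμ|} ≥ R/2 ) ≤ exp(−R/8)`. [ours] -/
theorem selfNormReweighting_medianOfBlocks_confidence_of_sq {y : Fin n → Ω → X}
    (hym : ∀ j, Measurable (y j)) (hind : iIndepFun y P) (hpm : Measurable p)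
    (hpi : Integrable p μ) (hp1 : ∫ z, p z ∂μ = 1) (hq0 : ∀ z, 0 < q z) (hqm : Measurable q)
    (hM2i : Integrable (fun z => p z ^ 2 / q z) μ) (hOm : Measurable O)
    (hVi : Integrable (fun z => p z ^ 2 / q z * O z ^ 2) μ)
    (hlaw : ∀ j, Measure.map (y j) P = μ.withDensity fun z => ENNReal.ofReal (q z))
    {wt : X → ℝ} {c : ℝ} (hc : 0 < c) (hwt : ∀ z, wt z = c * (p z / q z))
    (hm : 1 ≤ m) (hRm : R * m ≤ n) {t u : ℝ} (ht : 0 < t) (hu : 0 < u) (hu1 : u < 1)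
    (hvt : 8 * ∫ z, p z ^ 2 / q z * O z ^ 2 ∂μ ≤ m * t ^ 2)
    (hvu : 8 * ((∫ z, p z ^ 2 / q z ∂μ) - 1) ≤ m * u ^ 2) :
    P.real {ω | (R : ℝ) / 2 ≤ #{r ∈ (univ : Finset (Fin R)) |
        (t + Real.sqrt (∫ z, p z ^ 2 / q z * O z ^ 2 ∂μ) * u) / (1 - u) ≤
        |(∑ j : Fin m, wt (y ⟨((r : Fin R) : ℕ) * m + j, mul_add_lt hRm r j⟩ ω)
              * O (y ⟨((r : Fin R) : ℕ) * m + j, mul_add_lt hRm r j⟩ ω))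
            / (∑ j : Fin m, wt (y ⟨((r : Fin R) : ℕ) * m + j, mul_add_lt hRm r j⟩ ω))
          - ∫ z, p z * O z ∂μ|}} ≤ exp (-(R / 8)) := by
  rcases Nat.eq_zero_or_pos R with hR | hR
  · subst hR
    refine measureReal_le_one.trans ?_
    simp
  have hn : 0 < n := by
    have : 0 < R * m := Nat.mul_pos hR (by omega)
    omega
  have hν : IsProbabilityMeasure (μ.withDensity fun z => ENNReal.ofReal (q z)) :=
    isProbabilityMeasure_of_map_eq_iid (hym ⟨0, hn⟩) (hlaw ⟨0, hn⟩)
  set B : ℝ := Real.sqrt (∫ z, p z ^ 2 / q z * O z ^ 2 ∂μ) with hBdef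
  have ha : |∫ z, p z * O z ∂μ| ≤ B := abs_integral_targetMul_le_sqrt hν hpm hq0 hqm hOm hVi
  have hB0 : 0 ≤ B := Real.sqrt_nonneg _
  have hwtm : Measurable wt := by
    have : wt = fun z => c * (p z / q z) := funext hwt
    rw [this]
    exact (hpm.div hqm).const_mul c
  have hm0 : (0 : ℝ) < m := by exact_mod_cast hm
  -- the printed block estimate as a measurable function of the block; independence across blocks
  have hg : Measurable fun (v : Fin m → X) =>
      (∑ j : Fin m, wt (v j) * O (v j)) / (∑ j : Fin m, wt (v j)) :=
    (Finset.measurable_sum _ fun (j : Fin m) _ =>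
      (hwtm.comp (measurable_pi_apply j)).mul (hOm.comp (measurable_pi_apply j))).div
      (Finset.measurable_sum _ fun (j : Fin m) _ => hwtm.comp (measurable_pi_apply j))
  have hYind : iIndepFun (fun (r : Fin R) ω =>
      (∑ j : Fin m, wt (y ⟨(r : ℕ) * m + j, mul_add_lt hRm r j⟩ ω)
            * O (y ⟨(r : ℕ) * m + j, mul_add_lt hRm r j⟩ ω))
        / (∑ j : Fin m, wt (y ⟨(r : ℕ) * m + j, mul_add_lt hRm r j⟩ ω))) P :=
    iIndepFun_blockFun hym hind hRm hg
  have hYm : ∀ r : Fin R, Measurable fun ω =>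
      (∑ j : Fin m, wt (y ⟨(r : ℕ) * m + j, mul_add_lt hRm r j⟩ ω)
            * O (y ⟨(r : ℕ) * m + j, mul_add_lt hRm r j⟩ ω))
        / (∑ j : Fin m, wt (y ⟨(r : ℕ) * m + j, mul_add_lt hRm r j⟩ ω)) := fun r => by
    have hblk : Measurable fun ω => fun (i : Fin m) => y ⟨(r : ℕ) * m + i, mul_add_lt hRm r i⟩ ω :=
      measurable_pi_lambda _ fun i => hym _
    exact hg.comp hblk
  -- each block is bad with probability ≤ 1/8 + 1/8
  have hfar : ∀ r ∈ (univ : Finset (Fin R)), P.real {ω | (t + B * u) / (1 - u) ≤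
      |(∑ j : Fin m, wt (y ⟨(r : ℕ) * m + j, mul_add_lt hRm r j⟩ ω)
            * O (y ⟨(r : ℕ) * m + j, mul_add_lt hRm r j⟩ ω))
          / (∑ j : Fin m, wt (y ⟨(r : ℕ) * m + j, mul_add_lt hRm r j⟩ ω))
        - ∫ z, p z * O z ∂μ|} ≤ 1 / 4 := by
    intro r _
    have hE := blockMean_chebyshev_iid (ν := μ.withDensity fun z => ENNReal.ofReal (q z))
      (x := fun (i : Fin m) => y ⟨(r : ℕ) * m + i, mul_add_lt hRm r i⟩) (fun i => hym _)
      (iIndepFun_block hind hRm r) (fun i => hlaw _) (g := fun a => p a / q a * O a)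
      ((hpm.div hqm).mul hOm) (memLp_weightMul_model_of_sq hpm hq0 hqm hOm hVi) hm ht
    rw [integral_weightMul_model hq0 hqm] at hE
    have hEv := variance_weightMul_model_le_sq hν hpm hq0 hqm hOm hVi
    have hW := meanWeight_chebyshev_iid
      (x := fun (i : Fin m) => y ⟨(r : ℕ) * m + i, mul_add_lt hRm r i⟩) (fun i => hym _)
      (iIndepFun_block hind hRm r) hpm hpi hp1 hq0 hqm hM2i (fun i => hlaw _) hm hu
    have hratio : ∀ ω,
        (∑ j : Fin m, wt (y ⟨(r : ℕ) * m + j, mul_add_lt hRm r j⟩ ω)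
              * O (y ⟨(r : ℕ) * m + j, mul_add_lt hRm r j⟩ ω))
          / (∑ j : Fin m, wt (y ⟨(r : ℕ) * m + j, mul_add_lt hRm r j⟩ ω))
        = ((∑ j : Fin m, p (y ⟨(r : ℕ) * m + j, mul_add_lt hRm r j⟩ ω)
              / q (y ⟨(r : ℕ) * m + j, mul_add_lt hRm r j⟩ ω)
              * O (y ⟨(r : ℕ) * m + j, mul_add_lt hRm r j⟩ ω)) / m)
          / ((∑ j : Fin m, p (y ⟨(r : ℕ) * m + j, mul_add_lt hRm r j⟩ ω)
              / q (y ⟨(r : ℕ) * m + j, mul_add_lt hRm r j⟩ ω)) / m) := fun ω => by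
      rw [blockSelfNorm_scale_free hc hwt fun i => y ⟨(r : ℕ) * m + i, mul_add_lt hRm r i⟩ ω,
        blockSelfNorm_eq_div hm]
    have hsub : {ω | (t + B * u) / (1 - u) ≤
          |(∑ j : Fin m, wt (y ⟨(r : ℕ) * m + j, mul_add_lt hRm r j⟩ ω)
                * O (y ⟨(r : ℕ) * m + j, mul_add_lt hRm r j⟩ ω))
              / (∑ j : Fin m, wt (y ⟨(r : ℕ) * m + j, mul_add_lt hRm r j⟩ ω))
            - ∫ z, p z * O z ∂μ|}
        ⊆ {ω | t ≤ |(∑ j : Fin m, p (y ⟨(r : ℕ) * m + j, mul_add_lt hRm r j⟩ ω)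
              / q (y ⟨(r : ℕ) * m + j, mul_add_lt hRm r j⟩ ω)
              * O (y ⟨(r : ℕ) * m + j, mul_add_lt hRm r j⟩ ω)) / m - ∫ z, p z * O z ∂μ|}
          ∪ {ω | u ≤ |(∑ j : Fin m, p (y ⟨(r : ℕ) * m + j, mul_add_lt hRm r j⟩ ω)
              / q (y ⟨(r : ℕ) * m + j, mul_add_lt hRm r j⟩ ω)) / m - 1|} := by
      intro ω hω
      simp only [Set.mem_setOf_eq, Set.mem_union] at hω ⊢
      rw [hratio ω] at hω
      by_contra hcon
      simp only [not_or, not_le] at hcon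
      obtain ⟨h1, h2⟩ := hcon
      set A := (∑ j : Fin m, p (y ⟨(r : ℕ) * m + j, mul_add_lt hRm r j⟩ ω)
          / q (y ⟨(r : ℕ) * m + j, mul_add_lt hRm r j⟩ ω)
          * O (y ⟨(r : ℕ) * m + j, mul_add_lt hRm r j⟩ ω)) / m with hA
      set W := (∑ j : Fin m, p (y ⟨(r : ℕ) * m + j, mul_add_lt hRm r j⟩ ω)
          / q (y ⟨(r : ℕ) * m + j, mul_add_lt hRm r j⟩ ω)) / m with hW'
      set a := ∫ z, p z * O z ∂μ with ha'
      have hWlo : 1 - u ≤ W := by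
        have := (abs_lt.1 h2).1
        linarith
      have key : |A / W - a| ≤ (|A - a| + |a| * |W - 1|) / (1 - u) := by
        simpa only [div_one] using abs_div_sub_div_le (A := A) (B := W) (a := a) (b := 1)
          (β := 1 - u) (by linarith) hWlo one_ne_zero
      have hnum' : |A - a| + |a| * |W - 1| < t + B * u := by
        have h3 : |a| * |W - 1| ≤ B * u := mul_le_mul ha h2.le (abs_nonneg _) hB0
        linarith
      have hlt : |A / W - a| < (t + B * u) / (1 - u) :=
        key.trans_lt (div_lt_div_of_pos_right hnum' (by linarith))
      linarith
    have hE' : Var[fun a => p a / q a * O a; μ.withDensity fun z => ENNReal.ofReal (q z)]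
        / (m * t ^ 2) ≤ 1 / 8 := by
      rw [div_le_iff₀ (by positivity)]
      nlinarith [hEv]
    have hW' : ((∫ z, p z ^ 2 / q z ∂μ) - 1) / (m * u ^ 2) ≤ 1 / 8 := by
      rw [div_le_iff₀ (by positivity)]
      linarith
    calc P.real _ ≤ P.real _ := measureReal_mono hsub
      _ ≤ _ := measureReal_union_le _ _
      _ ≤ 1 / 8 + 1 / 8 := add_le_add (hE.trans hE') (hW.trans hW')
      _ = 1 / 4 := by norm_num
  have h := measureReal_half_far_le (μ := P) (univ : Finset (Fin R)) hYind hYm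
    (∫ z, p z * O z ∂μ) ((t + B * u) / (1 - u)) hfar
  simpa only [card_univ, Fintype.card_fin] using h

/-- **THE PRINTED SELF-NORMALISED ESTIMATE, NO CEILING, NO SUP BOUND, FOR ANY SAMPLE MEDIAN**
`med(ω)` of the `R` printed block estimates: under the same hypotheses,
`P((t + √V·u)/(1 − u) ≤ |med − ∫ p·O dμ|) ≤ exp(−R/8)`. [ours] -/
theorem selfNormReweighting_sampleMedian_confidence_of_sq {y : Fin n → Ω → X}
    (hym : ∀ j, Measurable (y j)) (hind : iIndepFun y P) (hpm : Measurable p)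
    (hpi : Integrable p μ) (hp1 : ∫ z, p z ∂μ = 1) (hq0 : ∀ z, 0 < q z) (hqm : Measurable q)
    (hM2i : Integrable (fun z => p z ^ 2 / q z) μ) (hOm : Measurable O)
    (hVi : Integrable (fun z => p z ^ 2 / q z * O z ^ 2) μ)
    (hlaw : ∀ j, Measure.map (y j) P = μ.withDensity fun z => ENNReal.ofReal (q z))
    {wt : X → ℝ} {c : ℝ} (hc : 0 < c) (hwt : ∀ z, wt z = c * (p z / q z))
    (hm : 1 ≤ m) (hRm : R * m ≤ n) {t u : ℝ} (ht : 0 < t) (hu : 0 < u) (hu1 : u < 1)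
    (hvt : 8 * ∫ z, p z ^ 2 / q z * O z ^ 2 ∂μ ≤ m * t ^ 2)
    (hvu : 8 * ((∫ z, p z ^ 2 / q z ∂μ) - 1) ≤ m * u ^ 2) {med : Ω → ℝ}
    (hlo : ∀ ω, (R : ℝ) / 2 ≤ #{r ∈ (univ : Finset (Fin R)) | med ω ≤
        (∑ j : Fin m, wt (y ⟨((r : Fin R) : ℕ) * m + j, mul_add_lt hRm r j⟩ ω)
              * O (y ⟨((r : Fin R) : ℕ) * m + j, mul_add_lt hRm r j⟩ ω))
            / (∑ j : Fin m, wt (y ⟨((r : Fin R) : ℕ) * m + j, mul_add_lt hRm r j⟩ ω))})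
    (hhi : ∀ ω, (R : ℝ) / 2 ≤ #{r ∈ (univ : Finset (Fin R)) |
        (∑ j : Fin m, wt (y ⟨((r : Fin R) : ℕ) * m + j, mul_add_lt hRm r j⟩ ω)
              * O (y ⟨((r : Fin R) : ℕ) * m + j, mul_add_lt hRm r j⟩ ω))
            / (∑ j : Fin m, wt (y ⟨((r : Fin R) : ℕ) * m + j, mul_add_lt hRm r j⟩ ω))
          ≤ med ω}) :
    P.real {ω | (t + Real.sqrt (∫ z, p z ^ 2 / q z * O z ^ 2 ∂μ) * u) / (1 - u)
        ≤ |med ω - ∫ z, p z * O z ∂μ|} ≤ exp (-(R / 8)) := by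
  refine (measureReal_mono ?_).trans
    (selfNormReweighting_medianOfBlocks_confidence_of_sq hym hind hpm hpi hp1 hq0 hqm hM2i hOm hVi
      hlaw hc hwt hm hRm ht hu hu1 hvt hvu)
  intro ω hω
  simp only [Set.mem_setOf_eq] at hω ⊢
  by_contra hlt
  push Not at hlt
  have hR : (#(univ : Finset (Fin R)) : ℝ) = R := by rw [card_univ, Fintype.card_fin]
  have h := abs_median_sub_lt_of_card_lt (univ : Finset (Fin R)) _ (hR ▸ hlo ω) (hR ▸ hhi ω)
    (hR ▸ hlt)
  linarith

end SelfNorm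

end Summit.Ventures.LatticeQCDFlow.Scoring.ReweightingMedian

end
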